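import Summits.ResolutionOfSingularities.ResolutionOfSingularities.Theorems.DeltaCutSep
import HarnessLib

/-!
# DeltaCutSep2 — decomp-res node «SepCut» (lens-6 g26, critic row 196 CLEARED +1), tree file 2/8 of the node

Content VERBATIM from the decomp-res lens-6 g26 node `HOME/decomp-res-lens-6/g26/SepCut.lean` (pin f15f025c; no
carry, imports the landed tree only); HOME = run/shared/lean/pub/decomp-res; critic row 196 CLEARED +1; landing plan
NEXT-g27.md fb3fac1c §4 + rider INBOX :1178 — provenance, critic text and the lens header in full in the first file
of the node, `DeltaCutSep`.  Namespace `…Theorems.DeltaCutClasses`; `--supports stmt-ResolutionOfSingularities-26971`.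

## This file

Continuation 2/2 of `DeltaCutSep` (same section of the node, cut at the 400-line cap): carries `sep_trichotomy`,
`not_sepTerminates_iff`, `badClosureCentre_eq_badCentre`, `sepActive_of_badFinite`, `isClosed_support_of_isBase`,
`badLocus_subset_support`, `closure_badLocus_subset_support`, `idealOrder_eq_of_mem_support`,
`support_badClosureCentre_subset_support`, `support_oldTopCentre_subset_support`, `wor_of_sepTerminatesAt`,
`wor_of_sepTerminates`.

[WRITER NOTE (decomp-res writer g12): file split only (tree files ≤ 400 lines); namespace, sections, section opens
and every declaration exactly as in the lens (the node's HOME-only dupNamespace-linter line is dropped; the two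
namespace-level `open …TwistCutClasses` / `open …LightCutClasses` lines of the node are replayed).]

(Sources: Hironaka1967 (characteristic polyhedra); CossartJannsenSaito2020 Def. 3.13 / Thm. 3.14, Ch. 8, Thm. 9.6;
Hironaka1970 (near points / vertices); CossartPiltant2019 Prop. 2.6; CossartPiltant2008 §2; Giraud1975; Hironaka2005
(three key theorems: order under permissible blow-up); EGAIV4 §16–§17; StacksProject 0804 / 0BIQ / 031I; Matsumura1987 §28.)
-/

noncomputable section

open CategoryTheory CategoryTheory.Limits AlgebraicGeometry TopologicalSpace IsLocalRing
open Literature.AlgebraicGeometry.Resolution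

universe u

namespace Summit.ResolutionOfSingularities.ResolutionOfSingularities.Theorems.DeltaCutClasses

open Summit.ResolutionOfSingularities.ResolutionOfSingularities.Theorems.TwistCutClasses
open Summit.ResolutionOfSingularities.ResolutionOfSingularities.Theorems.LightCutClasses

section SepLaw

open Summit.ResolutionOfSingularities.ResolutionOfSingularities.Theorems
open WeakOrderReduction ForcedTowerClasses SubfieldContactClasses AbsoluteContactClasses PurityValveClasses

/-- **TRICHOTOMY OF THE SEPARATING RUN** (hypothesis-free): it terminates, or freezes, or is perpetual — the first inactive
level, if any, exists by `Nat.find` and is either empty-bad or irregular-closure. [new] [folklore] -/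
theorem sep_trichotomy (n : ℕ) (N : Stage) : SepTerminates n N ∨ SepFrozen n N ∨ SepPerpetual n N := by
  classical
  by_cases hP : SepPerpetual n N
  · exact Or.inr (Or.inr hP)
  · have hex : ∃ i : ℕ, ¬ SepActive n (sepRun n N i) := not_forall.mp hP
    have hh : ¬ SepActive n (sepRun n N (Nat.find hex)) := Nat.find_spec hex
    have hpre : ∀ j < Nat.find hex, SepActive n (sepRun n N j) := fun j hj => not_not.mp (Nat.find_min hex hj)
    by_cases he : BadEmpty n (sepRun n N (Nat.find hex))
    · exact Or.inl ⟨Nat.find hex, hpre, he⟩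
    · exact Or.inr (Or.inl ⟨Nat.find hex, hpre, he, fun hr => hh ⟨he, hr⟩⟩)

/-- **THE RESIDUAL LETTER READ EXACTLY**: `¬ SepTerminates ⟺ SepFrozen ∨ SepPerpetual` (hypothesis-free). [new] [folklore] -/
theorem not_sepTerminates_iff (n : ℕ) (N : Stage) : ¬ SepTerminates n N ↔ SepFrozen n N ∨ SepPerpetual n N := by
  constructor
  · intro h
    rcases sep_trichotomy n N with ht | hf | hp
    · exact absurd ht h
    · exact Or.inl hf
    · exact Or.inr hp
  · rintro (hf | hp) ht
    · exact ht.not_sepFrozen hf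
    · exact ht.not_sepPerpetual hp

/-- At a FINITE level the step-1 centre IS g25's centre (a finite set of closed points is closed). [folklore] -/
theorem badClosureCentre_eq_badCentre {n : ℕ} {N : Stage} (h : BadFinite n N) : badClosureCentre n N = badCentre n N h := by
  unfold badClosureCentre badCentre
  congr 1
  exact TopologicalSpace.Closeds.ext
    (isClosed_of_finite_of_isClosed_singleton h fun _ hy => hy.1).closure_eq

/-- hence a FINITE NONEMPTY level is ACTIVE (its reduced bad locus is a regular scheme, g25
`isRegular_subscheme_badCentre`). [new] [folklore] -/
theorem sepActive_of_badFinite {n : ℕ} {N : Stage} [IsLocallyNoetherian N.Y] (h : BadFinite n N) (hne : ¬ BadEmpty n N) :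
    SepActive n N := by
  refine ⟨hne, ?_⟩
  show Scheme.IsRegular (badClosureCentre n N).subscheme
  rw [badClosureCentre_eq_badCentre h]
  exact isRegular_subscheme_badCentre n N h

end SepLaw

section SepEngine

open Summit.ResolutionOfSingularities.ResolutionOfSingularities.Theorems
open WeakOrderReduction ForcedTowerClasses SubfieldContactClasses AbsoluteContactClasses PurityValveClasses
open Scheme.IdealSheafData (vanishingIdeal)

/-! ### §SepEngine — PERMISSIBILITY PROVED and the ENGINE ITERATED (one theorem for ALL heights, from `SeqDimFour 5 n`) -/

/-- the support of an order-bounded datum over a base is CLOSED (upper semicontinuity of the order, tree `orderUSC_holds`).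
[folklore] -/
theorem isClosed_support_of_isBase {k : Type} [Field k] {Y : Scheme.{0}} {g : Y ⟶ Spec (.of k)} (hB : IsBase Y g)
    (M : MarkedIdeal Y) : IsClosed (M.support : Set Y) :=
  orderUSC_holds k Y g hB M.ideal M.mult

/-- the bad locus of a datum lies in its support. [folklore] -/
theorem badLocus_subset_support {Y : Scheme.{0}} {n : ℕ} {M : MarkedIdeal Y} (hM : IsDatum n M) :
    badLocus Y M.ideal n ⊆ M.support := fun y hy => by
  show (M.mult : ℕ∞) ≤ idealOrder M.ideal y
  rw [hM.1, hy.2.1]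

/-- **PERMISSIBILITY OF STEP 1 (the part «inside the top locus»)**: the closure of the bad locus of a base datum lies in the
support, and the order is EXACTLY `n` along it (USC + `ord ≤ n`). [new] [folklore] -/
theorem closure_badLocus_subset_support {k : Type} [Field k] {Y : Scheme.{0}} {g : Y ⟶ Spec (.of k)} (hB : IsBase Y g)
    {n : ℕ} {M : MarkedIdeal Y} (hM : IsDatum n M) : closure (badLocus Y M.ideal n) ⊆ M.support :=
  closure_minimal (badLocus_subset_support hM) (isClosed_support_of_isBase hB M)

/-- the order of a datum is exactly `n` on its support. [folklore] -/
theorem idealOrder_eq_of_mem_support {Y : Scheme.{0}} {n : ℕ} {M : MarkedIdeal Y} (hM : IsDatum n M) {y : Y}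
    (hy : y ∈ M.support) : idealOrder M.ideal y = ((n : ℕ) : ℕ∞) := by
  have hy' : (M.mult : ℕ∞) ≤ idealOrder M.ideal y := hy
  rw [hM.1] at hy'
  exact le_antisymm (hM.2 y) hy'

/-- **PERMISSIBILITY OF STEP 1**: the step-1 centre `𝓘(closure bad)` of a base `n`-datum lies INSIDE THE TOP LOCUS
(its support is
in the support of the datum, where the order is exactly `n`). [new] [folklore] -/
theorem support_badClosureCentre_subset_support {k : Type} [Field k] {Y : Scheme.{0}} {g : Y ⟶ Spec (.of k)} (hB : IsBase Y g)
    {n : ℕ} {M : MarkedIdeal Y} (hM : IsDatum n M) :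
    ((badClosureCentre n ⟨Y, M.ideal⟩).support : Set Y) ⊆ M.support := by
  rw [coe_support_badClosureCentre]; exact closure_badLocus_subset_support hB hM

/-- **PERMISSIBILITY OF STEP 2 — THE LIMIT-POINT LEMMA (proved, not remarked)**: for a base `n`-datum whose step-1 centre is
regular, the step-2 centre — the closure of `π₁⁻¹(T ∖ closure bad)`, i.e. the strict transform of the OLD top locus
— lies INSIDE
THE TOP LOCUS of the transformed datum: off the centre the order is transported
(`IsBlowup.idealOrder_controlledTransform_of_not_mem`), and the LIMIT POINTS on the exceptional divisor are caught because the
support upstairs is CLOSED (upper semicontinuity over the new base: `baseStable_holds` + `orderUSC_holds`). [new] [folklore] -/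
theorem support_oldTopCentre_subset_support {k : Type} [Field k] {Y : Scheme.{0}} {g : Y ⟶ Spec (.of k)} (hB : IsBase Y g)
    {n : ℕ} {M : MarkedIdeal Y} (hM : IsDatum n M) (hC₁reg : Scheme.IsRegular (badClosureCentre n ⟨Y, M.ideal⟩).subscheme) :
    ((oldTopCentre n ⟨Y, M.ideal⟩).support : Set _) ⊆
      (M.transform (blowup.π (badClosureCentre n ⟨Y, M.ideal⟩)) (badClosureCentre n ⟨Y, M.ideal⟩)).support := by
  have hB₁ : IsBase (blowup (badClosureCentre n ⟨Y, M.ideal⟩)) (blowup.π (badClosureCentre n ⟨Y, M.ideal⟩) ≫ g) :=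
    baseStable_holds k Y g hB _ hC₁reg
  rw [coe_support_oldTopCentre]
  refine closure_minimal (fun y' hy' => ?_) (isClosed_support_of_isBase hB₁ _)
  obtain ⟨hyT, hyC⟩ := hy'
  have hy'C : (blowup.π (badClosureCentre n ⟨Y, M.ideal⟩)).base y' ∉
      ((badClosureCentre n ⟨Y, M.ideal⟩).support : Set Y) := by
    rw [coe_support_badClosureCentre]; exact hyC
  show ((M.transform _ _).mult : ℕ∞) ≤ idealOrder (M.transform _ _).ideal y'
  rw [MarkedIdeal.transform_mult, MarkedIdeal.transform_ideal, hM.1,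
    (blowup.isBlowup _).idealOrder_controlledTransform_of_not_mem M.ideal n hy'C]
  exact hyT

/-- **THE ENGINE ITERATED (one theorem for ALL heights).**  For every `h`: a base `n`-datum whose separating run is ACTIVE below
level `h` and has EMPTY bad locus at level `h` has a weak resolution, given `SeqDimFour 5 n` — by induction on `h` generalising
the stage.  `h = 0`: g23's closing law `wor_of_splitOrLightOrDeltaLight` (no bad point: every wild closed top point is δ-light).
`h + 1`: STEP 1 blows up `C₁ = 𝓘(closure bad)` — REGULAR by the activity test, INSIDE THE TOP LOCUS by
`closure_badLocus_subset_support` (so weakly admissible; base upstairs `baseStable_holds`, datum upstairs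
`isDatum_transform_blowup`); if the strict transform `C₂` of the old top locus is regular, STEP 2 blows it up — it
lies inside the
new top locus because orders off `C₁` are transported (`IsBlowup.idealOrder_controlledTransform_of_not_mem`) and the support
upstairs is closed; the separating run of the transformed datum IS the tail of the run (`sepRun_succ_front` + the stage
identities), so the induction hypothesis resolves it; splice one or two centres in front (`CentreSeq.cons`). [new] [folklore] -/
theorem wor_of_sepTerminatesAt {n : ℕ} (hn : 1 ≤ n) (h5 : SeqDimFour 5 n) (p : ℕ) (hp : p.Prime) (k : Type) [Field k]
    [CharP k p] : ∀ (h : ℕ) (Y : Scheme.{0}) (g : Y ⟶ Spec (.of k)), IsBase Y g → ∀ M : MarkedIdeal Y, IsDatum n M →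
      (∀ j < h, SepActive n (sepRun n ⟨Y, M.ideal⟩ j)) → BadEmpty n (sepRun n ⟨Y, M.ideal⟩ h) →
        ∃ t : CentreSeq Y, WeakResolution t M := by
  intro h
  induction h with
  | zero =>
    intro Y g hB M hM _ hemp
    have hemp' : badLocus Y M.ideal n = ∅ := hemp
    refine wor_of_splitOrLightOrDeltaLight hn h5 p hp k Y g hB M hM fun y' hw => Or.inr ?_
    by_contra hnd
    have hy' : y' ∈ badLocus Y M.ideal n := ⟨hw.1, hw.2.1, hw.2.2, hnd⟩
    rw [hemp'] at hy'
    exact hy'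
  | succ h ih =>
    intro Y g hB M hM hpre hemp
    haveI : IsLocallyNoetherian Y := isLocallyNoetherian_of_isBase hB
    have hact : SepActive n ⟨Y, M.ideal⟩ := hpre 0 (Nat.succ_pos h)
    -- STEP 1: the reduced closure of the bad locus
    have hC₁reg : Scheme.IsRegular (badClosureCentre n ⟨Y, M.ideal⟩).subscheme := hact.2
    have hC₁supp : ((badClosureCentre n ⟨Y, M.ideal⟩).support : Set Y) = closure (badLocus Y M.ideal n) :=
      coe_support_badClosureCentre n ⟨Y, M.ideal⟩
    have hC₁sub : ((badClosureCentre n ⟨Y, M.ideal⟩).support : Set Y) ⊆ M.support :=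
      support_badClosureCentre_subset_support hB hM
    have hC₁top : ∀ y ∈ ((badClosureCentre n ⟨Y, M.ideal⟩).support : Set Y), idealOrder M.ideal y = ((n : ℕ) : ℕ∞) :=
      fun y hy => idealOrder_eq_of_mem_support hM (hC₁sub hy)
    have hB₁ : IsBase (blowup (badClosureCentre n ⟨Y, M.ideal⟩)) (blowup.π (badClosureCentre n ⟨Y, M.ideal⟩) ≫ g) :=
      baseStable_holds k Y g hB _ hC₁reg
    have hM₁ : IsDatum n (M.transform (blowup.π (badClosureCentre n ⟨Y, M.ideal⟩)) (badClosureCentre n ⟨Y, M.ideal⟩)) :=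
      isDatum_transform_blowup hB hM hC₁reg hC₁top
    haveI : IsLocallyNoetherian (blowup (badClosureCentre n ⟨Y, M.ideal⟩)) := isLocallyNoetherian_of_isBase hB₁
    -- the step-1 stage identity
    have hS₁ : stepOne n ⟨Y, M.ideal⟩ =
        ⟨blowup (badClosureCentre n ⟨Y, M.ideal⟩),
          (M.transform (blowup.π (badClosureCentre n ⟨Y, M.ideal⟩)) (badClosureCentre n ⟨Y, M.ideal⟩)).ideal⟩ := by
      rw [MarkedIdeal.transform_ideal, hM.1]
    by_cases hreg₂ : OldTopRegular n ⟨Y, M.ideal⟩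
    · -- STEP 2 fires: the strict transform of the old top locus is regular
      have hC₂reg : Scheme.IsRegular (oldTopCentre n ⟨Y, M.ideal⟩).subscheme := hreg₂
      have hC₂sub : ((oldTopCentre n ⟨Y, M.ideal⟩).support : Set _) ⊆
          (M.transform (blowup.π (badClosureCentre n ⟨Y, M.ideal⟩)) (badClosureCentre n ⟨Y, M.ideal⟩)).support :=
        support_oldTopCentre_subset_support hB hM hC₁reg
      have hC₂top : ∀ y' ∈ ((oldTopCentre n ⟨Y, M.ideal⟩).support : Set _),
          idealOrder (M.transform (blowup.π (badClosureCentre n ⟨Y, M.ideal⟩)) (badClosureCentre n ⟨Y, M.ideal⟩)).ideal y' =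
            ((n : ℕ) : ℕ∞) := fun y' hy' => idealOrder_eq_of_mem_support hM₁ (hC₂sub hy')
      have hB₂ : IsBase (blowup (oldTopCentre n ⟨Y, M.ideal⟩))
          (blowup.π (oldTopCentre n ⟨Y, M.ideal⟩) ≫ blowup.π (badClosureCentre n ⟨Y, M.ideal⟩) ≫ g) :=
        baseStable_holds k _ _ hB₁ _ hC₂reg
      have hM₂ : IsDatum n ((M.transform (blowup.π (badClosureCentre n ⟨Y, M.ideal⟩)) (badClosureCentre n ⟨Y, M.ideal⟩)).transform
          (blowup.π (oldTopCentre n ⟨Y, M.ideal⟩)) (oldTopCentre n ⟨Y, M.ideal⟩)) :=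
        isDatum_transform_blowup hB₁ hM₁ hC₂reg hC₂top
      -- the stage identity: the separating hop of `(Y, 𝓘)` IS `(Bl_{C₂} Bl_{C₁} Y, twice transformed ideal)`
      have hS₂ : (sepHop n ⟨Y, M.ideal⟩).next =
          ⟨blowup (oldTopCentre n ⟨Y, M.ideal⟩),
            (((M.transform (blowup.π (badClosureCentre n ⟨Y, M.ideal⟩)) (badClosureCentre n ⟨Y, M.ideal⟩)).transform
              (blowup.π (oldTopCentre n ⟨Y, M.ideal⟩)) (oldTopCentre n ⟨Y, M.ideal⟩))).ideal⟩ := by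
        rw [sepHop_next_of_regular hact hreg₂, MarkedIdeal.transform_ideal, MarkedIdeal.transform_mult,
          MarkedIdeal.transform_ideal, hM.1]
      have hpre' : ∀ j < h, SepActive n (sepRun n ⟨blowup (oldTopCentre n ⟨Y, M.ideal⟩),
          (((M.transform (blowup.π (badClosureCentre n ⟨Y, M.ideal⟩)) (badClosureCentre n ⟨Y, M.ideal⟩)).transform
            (blowup.π (oldTopCentre n ⟨Y, M.ideal⟩)) (oldTopCentre n ⟨Y, M.ideal⟩))).ideal⟩ j) := fun j hj => by
        have := hpre (j + 1) (Nat.succ_lt_succ hj)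
        rwa [sepRun_succ_front, hS₂] at this
      have hemp' : BadEmpty n (sepRun n ⟨blowup (oldTopCentre n ⟨Y, M.ideal⟩),
          (((M.transform (blowup.π (badClosureCentre n ⟨Y, M.ideal⟩)) (badClosureCentre n ⟨Y, M.ideal⟩)).transform
            (blowup.π (oldTopCentre n ⟨Y, M.ideal⟩)) (oldTopCentre n ⟨Y, M.ideal⟩))).ideal⟩ h) := by
        have := hemp
        rwa [sepRun_succ_front, hS₂] at this
      obtain ⟨t'', ht''⟩ := ih _ _ hB₂ _ hM₂ hpre' hemp'
      exact ⟨CentreSeq.cons (badClosureCentre n ⟨Y, M.ideal⟩) (CentreSeq.cons (oldTopCentre n ⟨Y, M.ideal⟩) t''),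
        ⟨hC₁sub, hC₁reg, hC₂sub, hC₂reg, ht''.1⟩, ht''.2⟩
    · -- STEP 2 skipped
      have hS₂ : (sepHop n ⟨Y, M.ideal⟩).next =
          ⟨blowup (badClosureCentre n ⟨Y, M.ideal⟩),
            (M.transform (blowup.π (badClosureCentre n ⟨Y, M.ideal⟩)) (badClosureCentre n ⟨Y, M.ideal⟩)).ideal⟩ := by
        rw [sepHop_next_of_not_regular hact hreg₂, hS₁]
      have hpre' : ∀ j < h, SepActive n (sepRun n ⟨blowup (badClosureCentre n ⟨Y, M.ideal⟩),
          (M.transform (blowup.π (badClosureCentre n ⟨Y, M.ideal⟩)) (badClosureCentre n ⟨Y, M.ideal⟩)).ideal⟩ j) :=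
        fun j hj => by
          have := hpre (j + 1) (Nat.succ_lt_succ hj)
          rwa [sepRun_succ_front, hS₂] at this
      have hemp' : BadEmpty n (sepRun n ⟨blowup (badClosureCentre n ⟨Y, M.ideal⟩),
          (M.transform (blowup.π (badClosureCentre n ⟨Y, M.ideal⟩)) (badClosureCentre n ⟨Y, M.ideal⟩)).ideal⟩ h) := by
        have := hemp
        rwa [sepRun_succ_front, hS₂] at this
      obtain ⟨t', ht'⟩ := ih _ _ hB₁ _ hM₁ hpre' hemp'
      exact ⟨CentreSeq.cons (badClosureCentre n ⟨Y, M.ideal⟩) t', ⟨hC₁sub, hC₁reg, ht'.1⟩, ht'.2⟩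

/-- **THE ENGINE · the decided cell closes**: a base `n`-datum whose separating run TERMINATES has a weak resolution, given
`SeqDimFour 5 n`. [new] [folklore] -/
theorem wor_of_sepTerminates {n : ℕ} (hn : 1 ≤ n) (h5 : SeqDimFour 5 n) (p : ℕ) (hp : p.Prime) (k : Type) [Field k]
    [CharP k p] (Y : Scheme.{0}) (g : Y ⟶ Spec (.of k)) (hB : IsBase Y g) (M : MarkedIdeal Y) (hM : IsDatum n M)
    (hsep : SepTerminates n ⟨Y, M.ideal⟩) : ∃ t : CentreSeq Y, WeakResolution t M := by
  obtain ⟨h, hpre, hemp⟩ := hsep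
  exact wor_of_sepTerminatesAt hn h5 p hp k h Y g hB M hM hpre hemp

end SepEngine

end Summit.ResolutionOfSingularities.ResolutionOfSingularities.Theorems.DeltaCutClasses
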